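import Literature.NumberTheory.EllipticCurves.IwasawaCharacterPsi
import HarnessLib

/-!
# The `Σ`-Euler factors `P_w(ε⁻¹Ψ⁻¹(frob_w)) ∈ Λ_𝒪` of an elliptic curve at places `w ∤ p` and the
# `Σ`-imprimitive modification `P_Σ = ∏_{w ∈ Σ} P_w` (the algebraic layer: reduction data as parameters)

Cell `bsd-stepL` (crux `stmt-BirchSwinnertonDyer-19270`, Road FF): the common currency of the fact
files F3 (`(L^Σ_p(g_m)) + (p^m) = (L^Σ_p(f)) + (p^m)`), F4 (`Ch(X^Σ(A_g))Λ^ur ⊂ (L^Σ_p(g))`) and F7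
(`char X^Σ = char X^∅ · ∏_{w∈Σ} (P_w)`, `L^Σ = L · P_Σ`) of SPEC-19270-RoadFF-facts-imc-p1-g8 §2.
DEFINITIONS WITH BODIES and proved lemmas; no named fact, no `sorry`, no instance, no notation. The
factors are defined from the LOCAL DATA of the curve at `w` (norm `Nw`, reduction type, trace `a_w`)
and the Frobenius exponent `c_w = κ(φ_w) ∈ ℤ_p` (`Ψ(φ_w) = (1 + T)^{c_w}`, file `IwasawaCharacterPsi`)
taken as PARAMETERS; attaching them to a Weierstrass curve and a place (`Nw = #k_w`, the reduction
type of `E/K_w`, `a_w = Nw + 1 − #Ẽ(k_w)`, `φ_w` an arithmetic Frobenius) is the fact files' binder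
list, not done here.

## Source and CONVENTION (see HOME/defn-ty1/EULER-FACTOR-CONVENTIONS-defn-ty1.md, evidence on the crux item)

* C. Skinner, Pacific J. Math. 283 (2016) §2.3 (p. 180): "Each `H¹(I_ℓ, 𝓜)^{G_{ℚ_ℓ}}`, `ℓ ≠ p`, is a
  cotorsion `Λ_𝒪`-module, and the `Λ_𝒪`-characteristic ideal of its Pontryagin dual is generated by
  `P_ℓ(Ψ⁻¹ε⁻¹(frob_ℓ))`, where `P_ℓ(X) = det(1 − X·frob_ℓ ∣ V_{f,I_ℓ})` with `V_{f,I_ℓ}` being the space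
  of `I_ℓ`-coinvariants … `Ch^{Σ₂}_L(f) ⊇ Ch^{Σ₁}_L(f) · ∏_{ℓ∈Σ₂∖Σ₁} (P_ℓ(Ψ⁻¹ε⁻¹(frob_ℓ)))`."
* D. Jetchev, C. Skinner, X. Wan, Camb. J. Math. 5 (2017) §5.1 (arXiv:1512.06894, tex p0022):
  "`L^Σ_p(f) = L_p(f) × ∏_{w∈Σ} P_w(ε⁻¹Ψ⁻¹(Frob_w)) ∈ R[[Γ]]`. … **Remark.** If `w = (ℓ)` is an inert
  place in `𝒦`, then `Ψ(Frob_w) = 1` and in this case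
  `P_w(ε⁻¹Ψ⁻¹(Frob_w)) = (1 − a_ℓ(f)ℓ⁻¹ + ℓ⁻¹)(1 + a_ℓ(f)ℓ⁻¹ + ℓ⁻¹)`, which can contribute to the
  `μ`-invariant of `L^Σ_p(f)`"; proof of Thm. 6.1.6 (tex p0026): "`χ_Λ(X^{Σ₂}_ac(M)) = χ_Λ(X^{Σ₁}_ac(M))
  ∏_{w∈Σ₂∖Σ₁} (P_w(ε⁻¹Ψ⁻¹(Frob_w)))`."
* F. Castella, Camb. J. Math. 6 (2018) (3.1): "`L^Σ_p(f) := L_p(f) × ∏_{w∈Σ} P_w(εΨ⁻¹(γ_w))` …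
  `P_w(X) := det(1 − X·Frob_w | V^{I_w})` … `Frob_w` a geometric Frobenius" — SCOPE CAVEAT: read with
  Skinner's convention below (the literal wording gives a value off by a non-unit at inert good primes
  and `0` at an inert multiplicative prime; see the memo).

CONVENTION ADOPTED (Skinner's; it reproduces JSW's Remark exactly): with `φ_w` an ARITHMETIC
Frobenius, `ε(φ_w) = Nw`, `u := Ψ(φ_w) = (1 + T)^{c_w}`, the factor is
`det(1 − Nw⁻¹u⁻¹·φ_w | V_{I_w})` (coinvariants), which for `E` equals, UP TO THE UNIT `Nw·u^{deg}`:
good reduction at `w` (`V_{I_w} = V`, char. poly. `X² − a_w X + Nw`): **`Nw·u² − a_w·u + 1`**;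
split multiplicative over `K_w` (`V_{I_w}` = trivial line): **`Nw·u − 1`**; non-split multiplicative
over `K_w` (`V_{I_w}` = the unramified quadratic character, `φ_w ↦ −1`): **`Nw·u + 1`**; additive
(`V_{I_w} = 0`): **`1`**. (At `T = 0`, i.e. `u = 1`: `Nw + 1 − a_w = #Ẽ(k_w)`, `Nw − 1`, `Nw + 1`, `1`
— the orders that the local cohomology `H¹(K_w, E[p^∞])` sees.) Only IDEALS generated by these
elements are ever used (F3/F4/F7), so the unit is immaterial; the orientation `u` vs `u⁻¹` is NOT
(do not substitute `u ↦ u⁻¹`).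

References: [Skinner2016PacificMC] §2.3 (p. 180); [JetchevSkinnerWan2017] §5.1 (display and Remark),
proof of Thm. 6.1.6; [Castella2018] (3.1); [GreenbergVatsal2000] Prop. 2.4 (cyclotomic analogue).
-/

noncomputable section

open PowerSeries

namespace Literature.NumberTheory.EllipticCurves.IwasawaCharacter

/-- The local reduction data of an elliptic curve at a finite place `w ∤ p` that its `Σ`-Euler
factor sees: good reduction with trace of Frobenius `a_w`, split multiplicative, non-split
multiplicative (both over the completion `K_w`), or additive. [cite: Skinner2016PacificMC, §2.3 (p. 180, `V_{f,I_ℓ}` the `I_ℓ`-coinvariants)] -/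
inductive LocalReductionData : Type
  | good (a : ℤ)
  | splitMult
  | nonsplitMult
  | additive
  deriving DecidableEq

section Factors

variable (p : ℕ) [Fact p.Prime] (𝒪 : Type*) [CommRing 𝒪] [Algebra ℤ_[p] 𝒪]

/-- **The `Σ`-Euler factor `P_w ∈ Λ_𝒪 = 𝒪⟦T⟧` at a place `w ∤ p`** with residue cardinality `Nw`,
reduction data `t` and Frobenius exponent `c = κ(φ_w)` (`u = Ψ(φ_w) = (1+T)^c`), in Skinner's
convention `det(1 − Nw⁻¹u⁻¹ φ_w | V_{I_w})` normalised by the unit `Nw·u^{deg}`: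
`Nw·u² − a_w·u + 1` (good), `Nw·u − 1` (split multiplicative), `Nw·u + 1` (non-split multiplicative),
`1` (additive). [cite: Skinner2016PacificMC, §2.3 (p. 180, "`P_ℓ(Ψ⁻¹ε⁻¹(frob_ℓ))`, `P_ℓ(X) = det(1 − X·frob_ℓ ∣ V_{f,I_ℓ})`")]
[cite: JetchevSkinnerWan2017, §5.1 (display "`L^Σ_p(f) = L_p(f) × ∏_{w∈Σ} P_w(ε⁻¹Ψ⁻¹(Frob_w))`" and the Remark on inert `w`)] -/
def eulerFactor (Nw : ℕ) (t : LocalReductionData) (c : ℤ_[p]) : PowerSeries 𝒪 :=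
  match t with
  | .good a => (Nw : PowerSeries 𝒪) * (onePlusTPow p 𝒪 c : PowerSeries 𝒪) ^ 2 -
      (a : PowerSeries 𝒪) * (onePlusTPow p 𝒪 c : PowerSeries 𝒪) + 1
  | .splitMult => (Nw : PowerSeries 𝒪) * (onePlusTPow p 𝒪 c : PowerSeries 𝒪) - 1
  | .nonsplitMult => (Nw : PowerSeries 𝒪) * (onePlusTPow p 𝒪 c : PowerSeries 𝒪) + 1
  | .additive => 1

/-- Unfolding at a place of good reduction. [cite: Skinner2016PacificMC, §2.3 (p. 180)] -/
theorem eulerFactor_good (Nw : ℕ) (a : ℤ) (c : ℤ_[p]) :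
    eulerFactor p 𝒪 Nw (.good a) c =
      (Nw : PowerSeries 𝒪) * (onePlusTPow p 𝒪 c : PowerSeries 𝒪) ^ 2 -
        (a : PowerSeries 𝒪) * (onePlusTPow p 𝒪 c : PowerSeries 𝒪) + 1 :=
  rfl

/-- Unfolding at a split multiplicative place. [cite: Skinner2016PacificMC, §2.3 (p. 180)] -/
theorem eulerFactor_splitMult (Nw : ℕ) (c : ℤ_[p]) :
    eulerFactor p 𝒪 Nw .splitMult c = (Nw : PowerSeries 𝒪) * (onePlusTPow p 𝒪 c : PowerSeries 𝒪) - 1 :=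
  rfl

/-- Unfolding at a non-split multiplicative place. [cite: Skinner2016PacificMC, §2.3 (p. 180)] -/
theorem eulerFactor_nonsplitMult (Nw : ℕ) (c : ℤ_[p]) :
    eulerFactor p 𝒪 Nw .nonsplitMult c = (Nw : PowerSeries 𝒪) * (onePlusTPow p 𝒪 c : PowerSeries 𝒪) + 1 :=
  rfl

/-- Unfolding at an additive place: no Euler factor. [cite: Skinner2016PacificMC, §2.3 (p. 180)] -/
theorem eulerFactor_additive (Nw : ℕ) (c : ℤ_[p]) : eulerFactor p 𝒪 Nw .additive c = 1 := rfl

/-- The constant term of `(1+T)^c` is `1` (`u ≡ 1 mod T`). [cite: Castella2018, §2.2 (p. 5, "`1 + T ↦ γ`")] -/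
theorem constantCoeff_onePlusTPow (c : ℤ_[p]) :
    constantCoeff (onePlusTPow p 𝒪 c : PowerSeries 𝒪) = 1 := by
  rw [val_onePlusTPow, PowerSeries.binomialSeries_constantCoeff]

/-- **The value at the trivial character** (`T = 0`, `u = 1`) of the good Euler factor is
`Nw − a_w + 1 = #Ẽ(k_w)`, the number of points of the reduction — the order that `H¹(K_w, E[p^∞])`
sees (JSW's Remark: at an inert `w`, `Ψ(Frob_w) = 1` and the factor is the constant
`(1 − a_ℓ ℓ⁻¹ + ℓ⁻¹)(1 + a_ℓ ℓ⁻¹ + ℓ⁻¹) = #Ẽ(𝔽_{ℓ²})/ℓ²`). [cite: JetchevSkinnerWan2017, §5.1 (Remark on inert places)] -/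
theorem constantCoeff_eulerFactor_good (Nw : ℕ) (a : ℤ) (c : ℤ_[p]) :
    constantCoeff (eulerFactor p 𝒪 Nw (.good a) c) = (Nw : 𝒪) - a + 1 := by
  simp [eulerFactor_good, map_natCast, map_intCast]

/-- At `T = 0` the split multiplicative factor is `Nw − 1`. [cite: Skinner2016PacificMC, §2.3 (p. 180)] -/
theorem constantCoeff_eulerFactor_splitMult (Nw : ℕ) (c : ℤ_[p]) :
    constantCoeff (eulerFactor p 𝒪 Nw .splitMult c) = (Nw : 𝒪) - 1 := by
  simp [eulerFactor_splitMult, map_natCast]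

/-- At `T = 0` the non-split multiplicative factor is `Nw + 1`. [cite: Skinner2016PacificMC, §2.3 (p. 180)] -/
theorem constantCoeff_eulerFactor_nonsplitMult (Nw : ℕ) (c : ℤ_[p]) :
    constantCoeff (eulerFactor p 𝒪 Nw .nonsplitMult c) = (Nw : 𝒪) + 1 := by
  simp [eulerFactor_nonsplitMult, map_natCast]

/-- **Places totally split in `K_∞` (`c = κ(φ_w) = 0`, e.g. the places of `K` inert over `ℚ` in the
anticyclotomic tower): the Euler factor is a CONSTANT** (`u = 1`), `Nw − a_w + 1`, `Nw ∓ 1` or `1` —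
it can only contribute to the `μ`-invariant (JSW's Remark). [cite: JetchevSkinnerWan2017, §5.1 (Remark: "`Ψ(Frob_w) = 1` … can contribute to the `μ`-invariant")] -/
theorem eulerFactor_zero (Nw : ℕ) (t : LocalReductionData) :
    eulerFactor p 𝒪 Nw t 0 =
      match t with
      | .good a => ((Nw : PowerSeries 𝒪) - a + 1)
      | .splitMult => ((Nw : PowerSeries 𝒪) - 1)
      | .nonsplitMult => ((Nw : PowerSeries 𝒪) + 1)
      | .additive => 1 := by
  cases t <;> simp [eulerFactor, onePlusTPow_zero]

end Factors

/-! ### The `Σ`-imprimitive modification `P_Σ = ∏_{w ∈ Σ} P_w` and `L^Σ = P_Σ · L` -/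

section Sigma

variable (p : ℕ) [Fact p.Prime] (𝒪 : Type*) [CommRing 𝒪] [Algebra ℤ_[p] 𝒪] {ι : Type*}

/-- **`P_Σ := ∏_{w ∈ Σ} P_w ∈ Λ_𝒪`** for a finite set `Σ` of places `w ∤ p` with local data
`(Nw, t_w, c_w)`. [cite: JetchevSkinnerWan2017, §5.1 ("`∏_{w∈Σ} P_w(ε⁻¹Ψ⁻¹(Frob_w))`")] [cite: Castella2018, (3.1)] -/
def sigmaEulerFactor (S : Finset ι) (Nw : ι → ℕ) (t : ι → LocalReductionData) (c : ι → ℤ_[p]) :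
    PowerSeries 𝒪 :=
  ∏ w ∈ S, eulerFactor p 𝒪 (Nw w) (t w) (c w)

/-- `P_∅ = 1`. [cite: JetchevSkinnerWan2017, §5.1] -/
@[simp] theorem sigmaEulerFactor_empty (Nw : ι → ℕ) (t : ι → LocalReductionData) (c : ι → ℤ_[p]) :
    sigmaEulerFactor p 𝒪 ∅ Nw t c = 1 :=
  Finset.prod_empty

/-- Adding a place multiplies `P_Σ` by its Euler factor: `P_{Σ ∪ {w}} = P_w · P_Σ` (`w ∉ Σ`).
[cite: JetchevSkinnerWan2017, proof of Thm. 6.1.6 ("`χ_Λ(X^{Σ₂}) = χ_Λ(X^{Σ₁}) ∏_{w∈Σ₂∖Σ₁} (P_w(…))`")] -/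
theorem sigmaEulerFactor_insert [DecidableEq ι] {S : Finset ι} {w : ι} (hw : w ∉ S) (Nw : ι → ℕ)
    (t : ι → LocalReductionData) (c : ι → ℤ_[p]) :
    sigmaEulerFactor p 𝒪 (insert w S) Nw t c =
      eulerFactor p 𝒪 (Nw w) (t w) (c w) * sigmaEulerFactor p 𝒪 S Nw t c :=
  Finset.prod_insert hw

/-- `P_{Σ₂} = P_{Σ₁} · ∏_{w ∈ Σ₂ ∖ Σ₁} P_w` for `Σ₁ ⊆ Σ₂`. [cite: JetchevSkinnerWan2017, proof of Thm. 6.1.6] [cite: Skinner2016PacificMC, §2.3 (p. 180, "`Ch^{Σ₂}_L(f) ⊇ Ch^{Σ₁}_L(f) · ∏_{ℓ∈Σ₂∖Σ₁} (P_ℓ(…))`")] -/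
theorem sigmaEulerFactor_eq_mul_sdiff [DecidableEq ι] {S₁ S₂ : Finset ι} (h : S₁ ⊆ S₂) (Nw : ι → ℕ)
    (t : ι → LocalReductionData) (c : ι → ℤ_[p]) :
    sigmaEulerFactor p 𝒪 S₂ Nw t c =
      sigmaEulerFactor p 𝒪 S₁ Nw t c * sigmaEulerFactor p 𝒪 (S₂ \ S₁) Nw t c := by
  unfold sigmaEulerFactor
  rw [← Finset.prod_union Finset.disjoint_sdiff, Finset.union_sdiff_of_subset h]

/-- **`L^Σ := P_Σ · L`**, the `Σ`-imprimitive modification of an element `L` of a `Λ_𝒪`-algebra `R`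
(the receptacle `Λ_{R₀} = R₀⟦T⟧` of the `p`-adic `L`-functions; `P_Σ` mapped along the structure map).
[cite: JetchevSkinnerWan2017, §5.1 ("`L^Σ_p(f) = L_p(f) × ∏_{w∈Σ} P_w(…)`")] [cite: Castella2018, (3.1)] -/
def sigmaImprimitive {R : Type*} [CommRing R] [Algebra (PowerSeries 𝒪) R] (S : Finset ι) (Nw : ι → ℕ)
    (t : ι → LocalReductionData) (c : ι → ℤ_[p]) (L : R) : R :=
  algebraMap (PowerSeries 𝒪) R (sigmaEulerFactor p 𝒪 S Nw t c) * L

/-- `L^∅ = L`. [cite: JetchevSkinnerWan2017, §5.1] -/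
@[simp] theorem sigmaImprimitive_empty {R : Type*} [CommRing R] [Algebra (PowerSeries 𝒪) R]
    (Nw : ι → ℕ) (t : ι → LocalReductionData) (c : ι → ℤ_[p]) (L : R) :
    sigmaImprimitive p 𝒪 ∅ Nw t c L = L := by
  simp [sigmaImprimitive]

end Sigma

/-! ### Non-vanishing (`P_w ≠ 0`, `P_Σ ≠ 0`: the glue's `hP`) -/

section NeZero

variable (p : ℕ) [Fact p.Prime] (𝒪 : Type*) [CommRing 𝒪] [Algebra ℤ_[p] 𝒪]

/-- A power series with non-zero constant term is non-zero; applied to the Euler factors.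
[cite: Skinner2016PacificMC, §2.3 (p. 180)] -/
theorem eulerFactor_ne_zero_of_constantCoeff {Nw : ℕ} {t : LocalReductionData} {c : ℤ_[p]}
    (h : constantCoeff (eulerFactor p 𝒪 Nw t c) ≠ 0) : eulerFactor p 𝒪 Nw t c ≠ 0 :=
  fun h0 => h (by rw [h0, map_zero])

/-- The additive "factor" `1` is non-zero. [cite: Skinner2016PacificMC, §2.3 (p. 180)] -/
theorem eulerFactor_additive_ne_zero [Nontrivial 𝒪] (Nw : ℕ) (c : ℤ_[p]) :
    eulerFactor p 𝒪 Nw .additive c ≠ 0 := by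
  rw [eulerFactor_additive]; exact one_ne_zero

/-- The good factor is non-zero as soon as the point count `Nw − a_w + 1 = #Ẽ(k_w)` is non-zero in `𝒪`.
[cite: JetchevSkinnerWan2017, §5.1 (Remark on inert places: the factor is `#Ẽ`-type, non-zero)] -/
theorem eulerFactor_good_ne_zero {Nw : ℕ} {a : ℤ} (c : ℤ_[p]) (h : (Nw : 𝒪) - a + 1 ≠ 0) :
    eulerFactor p 𝒪 Nw (.good a) c ≠ 0 :=
  eulerFactor_ne_zero_of_constantCoeff p 𝒪 (by rwa [constantCoeff_eulerFactor_good])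

/-- The split multiplicative factor is non-zero as soon as `Nw ≠ 1` in `𝒪`.
[cite: Skinner2016PacificMC, §2.3 (p. 180)] -/
theorem eulerFactor_splitMult_ne_zero {Nw : ℕ} (c : ℤ_[p]) (h : (Nw : 𝒪) - 1 ≠ 0) :
    eulerFactor p 𝒪 Nw .splitMult c ≠ 0 :=
  eulerFactor_ne_zero_of_constantCoeff p 𝒪 (by rwa [constantCoeff_eulerFactor_splitMult])

/-- The non-split multiplicative factor is non-zero as soon as `Nw + 1 ≠ 0` in `𝒪`.
[cite: Skinner2016PacificMC, §2.3 (p. 180)] -/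
theorem eulerFactor_nonsplitMult_ne_zero {Nw : ℕ} (c : ℤ_[p]) (h : (Nw : 𝒪) + 1 ≠ 0) :
    eulerFactor p 𝒪 Nw .nonsplitMult c ≠ 0 :=
  eulerFactor_ne_zero_of_constantCoeff p 𝒪 (by rwa [constantCoeff_eulerFactor_nonsplitMult])

/-- In characteristic `0`: the good factor is non-zero when the INTEGER `Nw − a + 1` (`= #Ẽ(k_w) ≥ 1`
for actual reduction data) is non-zero, and the multiplicative factors are non-zero when `Nw ≠ 1`
(`Nw = #k_w ≥ 2`). [cite: JetchevSkinnerWan2017, §5.1 (Remark on inert places)] -/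
theorem eulerFactor_ne_zero_of_charZero [CharZero 𝒪] {Nw : ℕ} (hNw : Nw ≠ 1) (t : LocalReductionData)
    (hgood : ∀ a : ℤ, t = .good a → (Nw : ℤ) - a + 1 ≠ 0) (c : ℤ_[p]) :
    eulerFactor p 𝒪 Nw t c ≠ 0 := by
  cases t with
  | good a =>
    refine eulerFactor_good_ne_zero p 𝒪 c ?_
    have h := hgood a rfl
    exact_mod_cast h
  | splitMult =>
    refine eulerFactor_splitMult_ne_zero p 𝒪 c ?_
    rw [sub_ne_zero]
    exact_mod_cast hNw
  | nonsplitMult =>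
    refine eulerFactor_nonsplitMult_ne_zero p 𝒪 c ?_
    exact_mod_cast Nat.succ_ne_zero Nw
  | additive => exact eulerFactor_additive_ne_zero p 𝒪 Nw c

variable {ι : Type*}

/-- **`P_Σ ≠ 0`** in the domain `Λ_𝒪` when every factor is non-zero (the glue's `hP`, via
`PowerSeries.map` injectivity downstream). [cite: JetchevSkinnerWan2017, §5.1] [cite: Skinner2016PacificMC, §2.3 (p. 180)] -/
theorem sigmaEulerFactor_ne_zero [IsDomain 𝒪] (S : Finset ι) (Nw : ι → ℕ) (t : ι → LocalReductionData)
    (c : ι → ℤ_[p]) (h : ∀ w ∈ S, eulerFactor p 𝒪 (Nw w) (t w) (c w) ≠ 0) :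
    sigmaEulerFactor p 𝒪 S Nw t c ≠ 0 :=
  Finset.prod_ne_zero_iff.2 h

end NeZero

end Literature.NumberTheory.EllipticCurves.IwasawaCharacter

end
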